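import Literature.NumberTheory.EllipticCurves.Curve6137TwoIsogenyDescent
import Literature.NumberTheory.EllipticCurves.IsogenyTwoTorsionProofs
import Literature.NumberTheory.EllipticCurves.IsogenyVariableChangeProofs
import Literature.NumberTheory.EllipticCurves.IsogenyCompProofs
import Literature.NumberTheory.EllipticCurves.IsogenyMordellWeilRankProofs
import Literature.NumberTheory.EllipticCurves.SelmerCorankIsogenyProofs
import Literature.NumberTheory.EllipticCurves.IwasawaLeadingTermProofs
import HarnessLib

/-!
# `X : y² = x³ − 8x² + x` has rank `0` and `t_2(X) = corank_{ℤ₂} Ш(X/ℚ)[2^∞] = 0`, by a SHARP descent via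
# `2`-isogeny on the isogenous curve `Y : y² = x(x − 6)(x + 4)` (Silverman, AEC X.4.9; isogeny invariance)

Topic `NumberTheory/EllipticCurves`. First of three files on the isogeny class of the curve with full rational
`2`-torsion `X' : y² = x(x + 6)(x + 10) = [0, 16, 0, 60, 0]`, whose quotient by `⟨(0,0)⟩` is (a model of)
`X = [0, −8, 0, 1, 0] : y² = x³ − 8x² + x` (`X' = X.twoIsogenyCodomain`; `Δ(X) = 960`, `j(X) = 244³/15`). The
point: `Ш(X/ℚ)[2] ≠ 0` (third file, `XCubeSub8XSqAddXSha`), so the descent via `X → X'` cannot decide the rank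
of `X`; but the descent via the `2`-isogeny of `X'` with kernel `⟨(−6, 0)⟩` is sharp, and rank and
`t_p = corank_{ℤ_p} Ш[p^∞]` are isogeny invariants (tree theorems `IsIsogenous.mordellWeilRank_eq`,
`IsIsogenous.shaCorank_eq`).

* §0 the curves `X`, `X'`, `Y = ⟨1, −6, 0, 0⟩ • X' = [0, −2, 0, −24, 0]` and their ellipticity;
* §1 on `Y`: `S(−2, −24) ⊆ {±1, ±6}` (the classes `±2, ±3` die modulo `5`), `S'(−2, −24) = S(4, 100) ⊆ {1}`
  (classes die modulo `3`, `16`, `128`) — Silverman's congruence method, tree lemma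
  `Carrier6137.not_isSoluble_padic_twoIsogenyQuartic_of_zmodPow` — hence `rank Y(ℚ) = 0` (`rank + 2 ≤
  dim₂ S + dim₂ S'`, tree `twoIsogeny_mordellWeilRank_add_two_le_holds`), the descent is sharp, `Ш(Y/ℚ)[2] = 0`
  (tree `forall_mem_sha_two_smul_eq_zero_of_selmerRank_add_le`), `t_2(Y) = 0`;
* §2 `X ~ Y` (`isIsogenous_twoIsogenyCodomain` and the translation), **`rank X(ℚ) = 0`**, **`t_2(X) = 0`**,
  `Ш(X/ℚ)[2^∞]` finite.

Everything is re-verified by the kernel (obstruction moduli found by a plain search). Theorems only; no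
definitions, no named facts.

## References

* [SilvermanAEC2009] J. H. Silverman, *The Arithmetic of Elliptic Curves*, 2nd ed.: Prop. X.4.9, Example X.4.10,
  Prop. X.4.7 with Thm. X.4.2(a), III.4.5 (the `2`-isogeny), III.6.
* [SilvermanTate2015] J. H. Silverman, J. Tate, *Rational Points on Elliptic Curves*, §3.6.
* [Greenberg1999LNM] R. Greenberg, LNM 1716, §1 pp. 54–57; [MilneADT2006] J. S. Milne, *ADT*, I.7.
-/

noncomputable section

open scoped Classical

namespace Literature.NumberTheory.EllipticCurves

namespace XCubeSub8XSqAddX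

open _root_.WeierstrassCurve _root_.WeierstrassCurve.Affine

/-! ## 0. The curves -/

/-- `b(a² − 4b) ≠ 0` for `X = E_{−8,1}`. [cite: SilvermanAEC2009, Prop. X.4.9] -/
theorem habX : (1 : ℤ) * ((-8 : ℤ) ^ 2 - 4 * 1) ≠ 0 := by norm_num

/-- `b(a² − 4b) ≠ 0` for `Y = E_{−2,−24}`. [cite: SilvermanAEC2009, Prop. X.4.9] -/
private theorem habY : (-24 : ℤ) * ((-2 : ℤ) ^ 2 - 4 * (-24)) ≠ 0 := by norm_num

/-- The tree's literal `E_{−8,1}` is `X`. [cite: SilvermanAEC2009, Prop. X.4.9] -/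
theorem lit_X : (⟨0, ((-8 : ℤ) : ℚ), 0, ((1 : ℤ) : ℚ), 0⟩ : WeierstrassCurve ℚ) = ⟨0, -8, 0, 1, 0⟩ := by
  ext <;> push_cast <;> ring

/-- The tree's literal `E_{−2a, a²−4b}` for `(a,b) = (−8,1)` is `X' = [0, 16, 0, 60, 0]`. [cite: SilvermanAEC2009, Prop. X.4.9] -/
theorem lit_X' :
    (⟨0, ((-2 * (-8) : ℤ) : ℚ), 0, (((-8 : ℤ) ^ 2 - 4 * 1 : ℤ) : ℚ), 0⟩ : WeierstrassCurve ℚ) = ⟨0, 16, 0, 60, 0⟩ := by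
  ext <;> push_cast <;> ring

/-- The tree's literal `E_{−2,−24}` is `Y`. [cite: SilvermanAEC2009, Prop. X.4.9] -/
private theorem lit_Y : (⟨0, ((-2 : ℤ) : ℚ), 0, ((-24 : ℤ) : ℚ), 0⟩ : WeierstrassCurve ℚ) = ⟨0, -2, 0, -24, 0⟩ := by
  ext <;> push_cast <;> ring

/-- The half-model literal for `(a,b) = (−2,−24)`. [cite: SilvermanAEC2009, Prop. X.4.9] -/
private theorem lit_V₀Y :
    (⟨0, -((-2 : ℤ) : ℚ) / 2, 0, (((-2 : ℤ) : ℚ) ^ 2 - 4 * (-24 : ℤ)) / 16, 0⟩ : WeierstrassCurve ℚ) =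
      ⟨0, 1, 0, 25 / 4, 0⟩ := by
  ext <;> push_cast <;> ring

/-- `X = [0, −8, 0, 1, 0]` is an elliptic curve (`Δ = 960`). [cite: SilvermanAEC2009, Prop. X.4.9] -/
theorem isElliptic_X : (⟨0, -8, 0, 1, 0⟩ : WeierstrassCurve ℚ).IsElliptic := by
  rw [← lit_X]; exact isElliptic_mk_of_ne_zero (F := ℚ) habX

/-- `X' = [0, 16, 0, 60, 0]` is an elliptic curve. [cite: SilvermanAEC2009, Prop. X.4.9] -/
theorem isElliptic_X' : (⟨0, 16, 0, 60, 0⟩ : WeierstrassCurve ℚ).IsElliptic := by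
  rw [← lit_X']; exact isElliptic_mk_of_ne_zero (F := ℚ) (twoIsogenyCodomain_ne_zero habX)

/-- `Y = [0, −2, 0, −24, 0]` is an elliptic curve. [cite: SilvermanAEC2009, Prop. X.4.9] -/
theorem isElliptic_Y : (⟨0, -2, 0, -24, 0⟩ : WeierstrassCurve ℚ).IsElliptic := by
  rw [← lit_Y]; exact isElliptic_mk_of_ne_zero (F := ℚ) habY

/-- The half-model of `Y'` is an elliptic curve. [cite: SilvermanAEC2009, Prop. X.4.9] -/
private theorem isElliptic_V₀Y : (⟨0, 1, 0, 25 / 4, 0⟩ : WeierstrassCurve ℚ).IsElliptic := by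
  rw [← lit_V₀Y]; exact isElliptic_halfModel habY

/-! ## 1. The sharp descent on `Y = [0, −2, 0, −24, 0]`: rank `0`, `Ш(Y/ℚ)[2] = 0`, `t_2(Y) = 0` -/

/-- `S(-2, -24)` does not contain: `d = 2, -2, 3, -3` modulo `5` (no solution of either chart modulo the stated prime power).
[cite: SilvermanAEC2009, Example X.4.10 (the congruence method)] -/
theorem not_mem_S_Y :
    (2 : ℤ) ∉ twoIsogenySelmerGroup (-2) (-24) ∧
      (-2 : ℤ) ∉ twoIsogenySelmerGroup (-2) (-24) ∧
      (3 : ℤ) ∉ twoIsogenySelmerGroup (-2) (-24) ∧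
      (-3 : ℤ) ∉ twoIsogenySelmerGroup (-2) (-24) := by
  have hB : (-24 : ℤ) ≠ 0 := by norm_num
  haveI : Fact (Nat.Prime 5) := ⟨by norm_num⟩
  refine ⟨?_, ?_, ?_, ?_⟩
  · refine Carrier6137.not_mem_twoIsogenySelmerGroup_of_not_isSoluble hB 5 ?_
    rw [show (-24 : ℤ) / 2 = -12 by norm_num]
    exact Carrier6137.not_isSoluble_padic_twoIsogenyQuartic_of_zmodPow 1 (by decide)
  · refine Carrier6137.not_mem_twoIsogenySelmerGroup_of_not_isSoluble hB 5 ?_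
    rw [show (-24 : ℤ) / -2 = 12 by norm_num]
    exact Carrier6137.not_isSoluble_padic_twoIsogenyQuartic_of_zmodPow 1 (by decide)
  · refine Carrier6137.not_mem_twoIsogenySelmerGroup_of_not_isSoluble hB 5 ?_
    rw [show (-24 : ℤ) / 3 = -8 by norm_num]
    exact Carrier6137.not_isSoluble_padic_twoIsogenyQuartic_of_zmodPow 1 (by decide)
  · refine Carrier6137.not_mem_twoIsogenySelmerGroup_of_not_isSoluble hB 5 ?_
    rw [show (-24 : ℤ) / -3 = 8 by norm_num]
    exact Carrier6137.not_isSoluble_padic_twoIsogenyQuartic_of_zmodPow 1 (by decide)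

/-- A squarefree integer dividing `-24` is `±` a divisor of `6`. [cite: SilvermanAEC2009, Prop. X.4.9] -/
private theorem mem_of_dvd_bY {d : ℤ} (hsq : Squarefree d) (hd : d ∣ (-24 : ℤ)) :
    d ∈ ({1, -1, 2, -2, 3, -3, 6, -6} : Finset ℤ) := by
  have hrad : d ∣ 6 := by
    have h5 : d ∣ (6 : ℤ) ^ 3 := dvd_trans hd ⟨-9, by norm_num⟩
    exact (hsq.dvd_pow_iff_dvd (by norm_num)).mp h5
  have h1 : d.natAbs ∣ 6 := by
    have := Int.natAbs_dvd_natAbs.mpr hrad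
    simpa using this
  have h2 : d.natAbs ∈ Nat.divisors 6 := Nat.mem_divisors.mpr ⟨h1, by norm_num⟩
  rw [show Nat.divisors 6 = {1, 2, 3, 6} by decide] at h2
  simp only [Finset.mem_insert, Finset.mem_singleton] at h2 ⊢
  rcases Int.natAbs_eq d with h | h <;> rw [h] <;>
    rcases h2 with h2 | h2 | h2 | h2 <;> simp [h2]

/-- **`S(-2, -24) ⊆ {1, -1, 6, -6}`** (the images of `O`, `(−4,0)`, `(6,0)`, `T = (0,0)`). [cite: SilvermanAEC2009, Prop. X.4.9 and Example X.4.10] -/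
theorem twoIsogenySelmerGroup_Y_subset :
    twoIsogenySelmerGroup (-2) (-24) ⊆ ({1, -1, 6, -6} : Finset ℤ) := by
  intro d hd
  obtain ⟨hsq, hdvd, -⟩ := (mem_twoIsogenySelmerGroup_iff (a := -2) (by norm_num : (-24 : ℤ) ≠ 0)).mp hd
  have hmem := mem_of_dvd_bY hsq hdvd
  obtain ⟨h2, hm2, h3, hm3⟩ := not_mem_S_Y
  simp only [Finset.mem_insert, Finset.mem_singleton] at hmem ⊢
  rcases hmem with rfl | rfl | rfl | rfl | rfl | rfl | rfl | rfl
  · simp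
  · simp
  · exact absurd hd h2
  · exact absurd hd hm2
  · exact absurd hd h3
  · exact absurd hd hm3
  · simp
  · simp

/-- `S(4, 100)` does not contain: `d = -1, 2, 5, -10` modulo `3`; `d = -5, 10` modulo `16`; `d = -2` modulo `128` (no solution of either chart modulo the stated prime power).
[cite: SilvermanAEC2009, Example X.4.10 (the congruence method)] -/
theorem not_mem_S'_Y :
    (-1 : ℤ) ∉ twoIsogenySelmerGroup (4) (100) ∧
      (2 : ℤ) ∉ twoIsogenySelmerGroup (4) (100) ∧
      (-2 : ℤ) ∉ twoIsogenySelmerGroup (4) (100) ∧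
      (5 : ℤ) ∉ twoIsogenySelmerGroup (4) (100) ∧
      (-5 : ℤ) ∉ twoIsogenySelmerGroup (4) (100) ∧
      (10 : ℤ) ∉ twoIsogenySelmerGroup (4) (100) ∧
      (-10 : ℤ) ∉ twoIsogenySelmerGroup (4) (100) := by
  have hB : (100 : ℤ) ≠ 0 := by norm_num
  haveI : Fact (Nat.Prime 2) := ⟨by norm_num⟩
  haveI : Fact (Nat.Prime 3) := ⟨by norm_num⟩
  refine ⟨?_, ?_, ?_, ?_, ?_, ?_, ?_⟩
  · refine Carrier6137.not_mem_twoIsogenySelmerGroup_of_not_isSoluble hB 3 ?_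
    rw [show (100 : ℤ) / -1 = -100 by norm_num]
    exact Carrier6137.not_isSoluble_padic_twoIsogenyQuartic_of_zmodPow 1 (by decide)
  · refine Carrier6137.not_mem_twoIsogenySelmerGroup_of_not_isSoluble hB 3 ?_
    rw [show (100 : ℤ) / 2 = 50 by norm_num]
    exact Carrier6137.not_isSoluble_padic_twoIsogenyQuartic_of_zmodPow 1 (by decide)
  · refine Carrier6137.not_mem_twoIsogenySelmerGroup_of_not_isSoluble hB 2 ?_
    rw [show (100 : ℤ) / -2 = -50 by norm_num]
    exact Carrier6137.not_isSoluble_padic_twoIsogenyQuartic_of_zmodPow 7 (by decide +kernel)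
  · refine Carrier6137.not_mem_twoIsogenySelmerGroup_of_not_isSoluble hB 3 ?_
    rw [show (100 : ℤ) / 5 = 20 by norm_num]
    exact Carrier6137.not_isSoluble_padic_twoIsogenyQuartic_of_zmodPow 1 (by decide)
  · refine Carrier6137.not_mem_twoIsogenySelmerGroup_of_not_isSoluble hB 2 ?_
    rw [show (100 : ℤ) / -5 = -20 by norm_num]
    exact Carrier6137.not_isSoluble_padic_twoIsogenyQuartic_of_zmodPow 4 (by decide)
  · refine Carrier6137.not_mem_twoIsogenySelmerGroup_of_not_isSoluble hB 2 ?_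
    rw [show (100 : ℤ) / 10 = 10 by norm_num]
    exact Carrier6137.not_isSoluble_padic_twoIsogenyQuartic_of_zmodPow 4 (by decide)
  · refine Carrier6137.not_mem_twoIsogenySelmerGroup_of_not_isSoluble hB 3 ?_
    rw [show (100 : ℤ) / -10 = -10 by norm_num]
    exact Carrier6137.not_isSoluble_padic_twoIsogenyQuartic_of_zmodPow 1 (by decide)

/-- A squarefree integer dividing `100` is `±` a divisor of `10`. [cite: SilvermanAEC2009, Prop. X.4.9] -/
private theorem mem_of_dvd_bY' {d : ℤ} (hsq : Squarefree d) (hd : d ∣ (100 : ℤ)) :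
    d ∈ ({1, -1, 2, -2, 5, -5, 10, -10} : Finset ℤ) := by
  have hrad : d ∣ 10 := by
    have h5 : d ∣ (10 : ℤ) ^ 2 := dvd_trans hd ⟨1, by norm_num⟩
    exact (hsq.dvd_pow_iff_dvd (by norm_num)).mp h5
  have h1 : d.natAbs ∣ 10 := by
    have := Int.natAbs_dvd_natAbs.mpr hrad
    simpa using this
  have h2 : d.natAbs ∈ Nat.divisors 10 := Nat.mem_divisors.mpr ⟨h1, by norm_num⟩
  rw [show Nat.divisors 10 = {1, 2, 5, 10} by decide] at h2
  simp only [Finset.mem_insert, Finset.mem_singleton] at h2 ⊢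
  rcases Int.natAbs_eq d with h | h <;> rw [h] <;>
    rcases h2 with h2 | h2 | h2 | h2 <;> simp [h2]

/-- **`S(4, 100) ⊆ {1}`** (only the class of `O`). [cite: SilvermanAEC2009, Prop. X.4.9 and Example X.4.10] -/
theorem twoIsogenySelmerGroup'_Y_subset :
    twoIsogenySelmerGroup (4) (100) ⊆ ({1} : Finset ℤ) := by
  intro d hd
  obtain ⟨hsq, hdvd, -⟩ := (mem_twoIsogenySelmerGroup_iff (a := 4) (by norm_num : (100 : ℤ) ≠ 0)).mp hd
  have hmem := mem_of_dvd_bY' hsq hdvd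
  obtain ⟨hm1, h2, hm2, h5, hm5, h10, hm10⟩ := not_mem_S'_Y
  simp only [Finset.mem_insert, Finset.mem_singleton] at hmem ⊢
  rcases hmem with rfl | rfl | rfl | rfl | rfl | rfl | rfl | rfl
  · simp
  · exact absurd hd hm1
  · exact absurd hd h2
  · exact absurd hd hm2
  · exact absurd hd h5
  · exact absurd hd hm5
  · exact absurd hd h10
  · exact absurd hd hm10



/-- `2^k ≤ 2^n` forces `k ≤ n`. [cite: SilvermanAEC2009, Prop. X.4.9] -/
private theorem le_of_two_pow_le {k n : ℕ} (h : 2 ^ k ≤ 2 ^ n) : k ≤ n :=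
  (Nat.pow_le_pow_iff_right (by norm_num)).mp h

/-- **`dim₂ S(−2,−24) ≤ 2` and `dim₂ S'(−2,−24) ≤ 0`.** [cite: SilvermanAEC2009, Prop. X.4.9] -/
theorem twoIsogenySelmerRank_Y_add_le :
    twoIsogenySelmerRank (-2) (-24) ≤ 2 ∧ twoIsogenySelmerRank' (-2) (-24) ≤ 0 := by
  constructor
  · apply le_of_two_pow_le
    rw [two_pow_twoIsogenySelmerRank_eq_card habY]
    exact (Finset.card_le_card twoIsogenySelmerGroup_Y_subset).trans (by decide)
  · apply le_of_two_pow_le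
    rw [two_pow_twoIsogenySelmerRank'_eq_card habY, twoIsogenySelmerGroup'_eq,
      show (-2 * (-2) : ℤ) = 4 by norm_num, show ((-2 : ℤ) ^ 2 - 4 * (-24) : ℤ) = 100 by norm_num]
    exact (Finset.card_le_card twoIsogenySelmerGroup'_Y_subset).trans (by decide)

/-- **`rank Y(ℚ) = 0`** for `Y : y² = x(x − 6)(x + 4)`: `rank + 2 ≤ dim₂ S + dim₂ S' ≤ 2 + 0`.
[cite: SilvermanTate2015, §3.6] [cite: SilvermanAEC2009, Prop. X.4.7 with Thm. X.4.2(a)] -/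
theorem mordellWeilRank_Y : (⟨0, -2, 0, -24, 0⟩ : WeierstrassCurve ℚ).mordellWeilRank = 0 := by
  haveI := isElliptic_Y
  have h := twoIsogeny_mordellWeilRank_add_two_le_holds (-2) (-24) habY
  rw [lit_Y] at h
  have h2 := twoIsogenySelmerRank_Y_add_le
  omega

/-- **The descent on `Y` is sharp**: `dim₂ S + dim₂ S' ≤ rank + 2`. [cite: SilvermanAEC2009, Prop. X.4.7 with Thm. X.4.2(a)] -/
theorem twoIsogenySelmerRank_Y_add_le_rank :
    twoIsogenySelmerRank (-2) (-24) + twoIsogenySelmerRank' (-2) (-24) ≤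
      (⟨0, ((-2 : ℤ) : ℚ), 0, ((-24 : ℤ) : ℚ), 0⟩ : WeierstrassCurve ℚ).mordellWeilRank + 2 := by
  have h := twoIsogenySelmerRank_Y_add_le
  omega

/-- **`Ш(Y/ℚ)[2] = 0`** for `Y : y² = x(x − 6)(x + 4)`. [cite: SilvermanAEC2009, Prop. X.4.7 with Thm. X.4.2(a)] -/
theorem forall_mem_sha_Y_two_smul_eq_zero :
    ∀ c ∈ (⟨0, -2, 0, -24, 0⟩ : WeierstrassCurve ℚ).sha, 2 • c = 0 → c = 0 := by
  haveI : (⟨0, -((-2 : ℤ) : ℚ) / 2, 0, (((-2 : ℤ) : ℚ) ^ 2 - 4 * (-24 : ℤ)) / 16, 0⟩ :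
      WeierstrassCurve ℚ).IsElliptic := by rw [lit_V₀Y]; exact isElliptic_V₀Y
  haveI : (⟨0, ((-2 : ℤ) : ℚ), 0, ((-24 : ℤ) : ℚ), 0⟩ : WeierstrassCurve ℚ).IsElliptic := by
    rw [lit_Y]; exact isElliptic_Y
  have h := forall_mem_sha_two_smul_eq_zero_of_selmerRank_add_le (a := -2) (b := -24) habY
    twoIsogenySelmerRank_Y_add_le_rank
  rwa [lit_Y] at h

/-- **`t_2(Y) = corank_{ℤ₂} Ш(Y/ℚ)[2^∞] = 0`.** [cite: SilvermanAEC2009, Prop. X.4.7 with Thm. X.4.2(a)] -/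
theorem shaCorank_Y_two : (⟨0, -2, 0, -24, 0⟩ : WeierstrassCurve ℚ).shaCorank 2 = 0 := by
  haveI := isElliptic_Y
  haveI : Fact (Nat.Prime 2) := ⟨Nat.prime_two⟩
  exact shaCorank_eq_zero_of_forall _ 2 forall_mem_sha_Y_two_smul_eq_zero

/-! ## 2. `X ~ Y`: `rank X(ℚ) = 0` and `t_2(X) = 0` -/

/-- `X' = X.twoIsogenyCodomain`: the quotient of `X` by `⟨(0,0)⟩` is `[0, 16, 0, 60, 0] : y² = x(x+6)(x+10)`.
[cite: SilvermanAEC2009, III.4.5 (the explicit 2-isogeny)] -/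
theorem twoIsogenyCodomain_X :
    (⟨0, -8, 0, 1, 0⟩ : WeierstrassCurve ℚ).twoIsogenyCodomain = ⟨0, 16, 0, 60, 0⟩ := by
  rw [← lit_X, twoIsogenyCodomain_mk_intCast, lit_X']

/-- `Y = ⟨1, −6, 0, 0⟩ • X'`: moving the `2`-torsion point `(−6, 0)` of `X'` to the origin gives
`Y : y² = x(x − 6)(x + 4)`. [cite: SilvermanAEC2009, III.3.1(b)] -/
theorem smul_X'_eq_Y :
    (⟨1, -6, 0, 0⟩ : VariableChange ℚ) • (⟨0, 16, 0, 60, 0⟩ : WeierstrassCurve ℚ) = ⟨0, -2, 0, -24, 0⟩ := by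
  ext
  · simp [WeierstrassCurve.variableChange_a₁]
  · rw [WeierstrassCurve.variableChange_a₂]; norm_num
  · simp [WeierstrassCurve.variableChange_a₃]
  · rw [WeierstrassCurve.variableChange_a₄]; norm_num
  · rw [WeierstrassCurve.variableChange_a₆]; norm_num

/-- **`X ~ Y` over `ℚ`** (the `2`-isogeny `X → X'` followed by the isomorphism `X' ≅ Y`).
[cite: SilvermanAEC2009, III.4.5 and III.6] -/
theorem isIsogenous_X_Y :
    IsIsogenous (⟨0, -8, 0, 1, 0⟩ : WeierstrassCurve ℚ) (⟨0, -2, 0, -24, 0⟩ : WeierstrassCurve ℚ) := by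
  haveI := isElliptic_X
  have h1 : IsIsogenous (⟨0, -8, 0, 1, 0⟩ : WeierstrassCurve ℚ) (⟨0, 16, 0, 60, 0⟩ : WeierstrassCurve ℚ) :=
    isIsogenous_of_eq_twoIsogenyCodomain _ twoIsogenyCodomain_X
  exact h1.trans' (isIsogenous_of_smul_eq smul_X'_eq_Y)

/-- **`rank X(ℚ) = 0`** for `X : y² = x³ − 8x² + x` (rank is an isogeny invariant; `rank Y(ℚ) = 0`).
[cite: MilneADT2006, proof of Thm. I.7.3 (p. 97)] [cite: SilvermanTate2015, §3.6] -/
theorem mordellWeilRank_X : (⟨0, -8, 0, 1, 0⟩ : WeierstrassCurve ℚ).mordellWeilRank = 0 := by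
  haveI := isElliptic_X
  haveI := isElliptic_Y
  rw [isIsogenous_X_Y.mordellWeilRank_eq, mordellWeilRank_Y]

/-- **`t_2(X) = corank_{ℤ₂} Ш(X/ℚ)[2^∞] = 0`** (`t_p` is an isogeny invariant; `t_2(Y) = 0` by the sharp
descent on `Y`). [cite: Greenberg1999LNM, §1 pp. 54–57] -/
theorem shaCorank_X_two : (⟨0, -8, 0, 1, 0⟩ : WeierstrassCurve ℚ).shaCorank 2 = 0 := by
  haveI := isElliptic_X
  haveI := isElliptic_Y
  haveI : Fact (Nat.Prime 2) := ⟨Nat.prime_two⟩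
  rw [isIsogenous_X_Y.shaCorank_eq 2, shaCorank_Y_two]

/-- **`Ш(X/ℚ)[2^∞]` is finite.** [cite: Greenberg1999LNM, §1 pp. 54–57] -/
theorem finite_primaryComponent_sha_X_two :
    Finite (AddCommGroup.primaryComponent (⟨0, -8, 0, 1, 0⟩ : WeierstrassCurve ℚ).sha 2) := by
  haveI := isElliptic_X
  haveI : Fact (Nat.Prime 2) := ⟨Nat.prime_two⟩
  exact (finite_primaryComponent_sha_iff_shaCorank_eq_zero _ 2).mpr shaCorank_X_two

end XCubeSub8XSqAddX

end Literature.NumberTheory.EllipticCurves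

end
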